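import Summits.NavierStokesRegularity.NavierStokesRegularity.Theses.QuantisedSymmetry
import Summits.NavierStokesRegularity.NavierStokesRegularity.Theses.Blowup
import Summits.NavierStokesRegularity.NavierStokesRegularity.Theorems.QuantisedSymmetryLiouvilleKillsProfile
import Summits.NavierStokesRegularity.NavierStokesRegularity.Theorems.QuantisedSymmetryPolyhedralDssProfileExistsDominatesBlowupProfile
import Summits.NavierStokesRegularity.NavierStokesRegularity.Theorems.QuantisedSymmetryPolyhedralDssProfileExistsCellOfProfile
import Summits.NavierStokesRegularity.NavierStokesRegularity.Theorems.FilamentSkeletonRssRdssProfileTruncation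
import Literature.Analysis.FluidPDE.SelfSimilarLiouville
import Literature.Analysis.FluidPDE.HyperbolicDSSOrbit
import Literature.Analysis.FluidPDE.ForwardRDSSExistence
import HarnessLib

/-!
# Strategist sketch S19g17 — crux `QuantisedSymmetry.PolyhedralDssProfileExists`
  (stmt-NavierStokesRegularity-1404), independent census family `s`, generation 17

Typed signatures behind `Cruxes/PolyhedralDssProfileExists/STRATEGY-CENSUS-s19.md`:

* `## Weaker intermediate` — the chain `X → W1 → W2 (= Blowup.BlowupTypeIDssProfile, stmt-0155)
  → W3 (= Blowup.BlowupExists, X5a) → ¬(A)`, every arrow a TREE theorem (`chain`); the kill-switch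
  negation `W0 = ¬ PolyhedralTypeILiouville` with `X → W0`; Perelman's backward RSS ansatz
  `BackwardRssProfileExists` (Bradshaw–Tsai 2017, §5 Open Problem 5.2) with `→ W2`, and the typed
  claim `RssExcludedFromSector` that X's polyhedral clause EXCLUDES it.
* `## Decomposition` — (D-A) approximate cells + compactness (`X_of_DA`), (D-B) Newton–Kantorovich /
  contraction certificate (`X_of_DB`, and the degenerate witness `unpinnedCertificate_of_cellExists`
  showing the unpinned certificate is X in costume), (D-C) kill-switch bridge (`X_of_DC`).
* `## Strengthen` — `HyperbolicPolyhedralProfile → X` (`X_of_hyperbolic`).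

Nothing here is a registered line: every split has one piece equivalent to (or stronger than) X with
no first stub; see the census for the reasons. No `sorry`.
-/

noncomputable section

set_option linter.dupNamespace false
set_option linter.unusedVariables false

namespace Summit.NavierStokesRegularity.NavierStokesRegularity.Cruxes.PolyhedralDssProfileExists.S19g17

open MeasureTheory Set Function Filter Topology
open Literature.Analysis.FluidPDE

/-- `ℝ³`. -/
abbrev E3 : Type := EuclideanSpace ℝ (Fin 3)

/-- The crux X⁻ (stmt-1404), by name. -/
abbrev X : Prop :=
  _root_.Summit.NavierStokesRegularity.NavierStokesRegularity.Theses.QuantisedSymmetry.PolyhedralDssProfileExists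

/-- The kill switch #3 (stmt-1405), by name. -/
abbrev KillSwitch : Prop :=
  _root_.Summit.NavierStokesRegularity.NavierStokesRegularity.Theses.QuantisedSymmetry.PolyhedralTypeILiouville

/-- `¬(A)`: the route's conclusion. -/
abbrev NotA : Prop := ¬ _root_.NavierStokesRegularity

/-- The three `G`-clauses of X: finite, proper rotations, irreducible on `ℝ³` (⇔ `G` ≅ T, O or I). -/
def IsPolyhedral (G : Subgroup (E3 ≃ₗᵢ[ℝ] E3)) : Prop :=
  Finite G ∧ (∀ g ∈ G, LinearMap.det (g.toLinearEquiv : E3 →ₗ[ℝ] E3) = 1) ∧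
    (∀ V : Submodule ℝ E3, (∀ g ∈ G, ∀ v ∈ V, g v ∈ V) → V = ⊥ ∨ V = ⊤)

/-- Symmetry-free Type-I `c`-DSS nontrivial ancient mild profile (the analytic clauses of X). -/
def IsProfile (c : ℝ) (u : ℝ → E3 → E3) : Prop :=
  IsAncientMildSolution 1 u ∧ (∀ t < 0, AEStronglyMeasurable (u t) volume) ∧
    IsDiscretelySelfSimilar c u ∧ (∃ C₀ : ℝ, HasTypeIDecay C₀ u) ∧ ¬ (∀ t < 0, u t =ᵐ[volume] 0)

/-- `G`-equivariance about the origin. -/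
def IsEquivariant (G : Subgroup (E3 ≃ₗᵢ[ℝ] E3)) (u : ℝ → E3 → E3) : Prop :=
  ∀ g ∈ G, ∀ t x, u t (g x) = g (u t x)

/-- X regrouped. -/
theorem X_iff : X ↔ ∃ G, IsPolyhedral G ∧ ∃ c : ℝ, 1 < c ∧ ∃ u, IsProfile c u ∧ IsEquivariant G u := by
  constructor
  · rintro ⟨G, hfin, hdet, hirr, c, hc, u, hanc, hmeas, hdss, hdec, heqv, hnt⟩
    exact ⟨G, ⟨hfin, hdet, hirr⟩, c, hc, u, ⟨hanc, hmeas, hdss, hdec, hnt⟩, heqv⟩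
  · rintro ⟨G, ⟨hfin, hdet, hirr⟩, c, hc, u, ⟨hanc, hmeas, hdss, hdec, hnt⟩, heqv⟩
    exact ⟨G, hfin, hdet, hirr, c, hc, u, hanc, hmeas, hdss, hdec, heqv, hnt⟩

/-! ## Weaker intermediates (summit-first) -/

/-- W₁: some factor's Type-I DSS Liouville statement fails. -/
def W1 : Prop := ∃ c : ℝ, 1 < c ∧ ¬ TypeIDSSLiouville c

/-- W₂ = `Blowup.BlowupTypeIDssProfile` (stmt-NavierStokesRegularity-0155, route Blowup #5, OPEN). -/
abbrev W2 : Prop :=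
  _root_.Summit.NavierStokesRegularity.NavierStokesRegularity.Theses.Blowup.BlowupTypeIDssProfile

/-- W₃ = `Blowup.BlowupExists` (X5a: a rapidly decaying datum with finite maximal smooth lifespan). -/
abbrev W3 : Prop := _root_.Summit.NavierStokesRegularity.NavierStokesRegularity.Theses.Blowup.BlowupExists

/-- W₀ = negation of the kill switch (a nontrivial Type-I polyhedral bounded ancient mild solution,
no self-similarity asked). -/
abbrev W0 : Prop := ¬ KillSwitch

/-- X → W₁ (tree: `exists_not_typeIDSSLiouville_of_polyhedralDssProfileExists`). -/
theorem w1_of_X : X → W1 :=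
  Theorems.PolyhedralDssProfileExists.PolyhedralCell.exists_not_typeIDSSLiouville_of_polyhedralDssProfileExists

/-- W₁ → W₂ (three lines of logic). -/
theorem w2_of_w1 : W1 → W2 := by
  rintro ⟨c, -, hc⟩
  dsimp only [W2, _root_.Summit.NavierStokesRegularity.NavierStokesRegularity.Theses.Blowup.BlowupTypeIDssProfile]
  exact fun hL => hc (hL c).1

/-- W₂ → W₃: the LANDED symmetry-free truncation bridge
`filamentSkeletonRss_rdssProfileTruncation_proof` (stmt-11289, ~1850 lines). -/
theorem w3_of_w2 : W2 → W3 := by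
  intro h
  by_contra hW
  apply h
  intro c
  have key : ∀ R : E3 ≃ₗᵢ[ℝ] E3, RotatedTypeIDSSLiouville c R := by
    intro R hc u hanc hmeas hdss hdec
    by_contra hnt
    exact hW (Theorems.filamentSkeletonRss_rdssProfileTruncation_proof
      ⟨c, R, u, hc, hanc, hmeas, hdss, hdec, hnt⟩)
  exact ⟨(rotatedTypeIDSSLiouville_refl_iff c).1 (key _), key⟩

/-- W₃ → ¬(A): route Blowup's deciding theorem with the discharged Clay uniqueness. -/
theorem notA_of_w3 : W3 → NotA := fun h =>
  _root_.Summit.NavierStokesRegularity.NavierStokesRegularity.Theses.Blowup.closes h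
    _root_.Summit.NavierStokesRegularity.NavierStokesRegularity.Theses.Blowup.BlowupClayUniqueness_holds

/-- The whole chain is in the tree: every weaker intermediate between X and ¬(A) is itself
summit-deciding. -/
theorem chain : (X → W1) ∧ (W1 → W2) ∧ (W2 → W3) ∧ (W3 → NotA) :=
  ⟨w1_of_X, w2_of_w1, w3_of_w2, notA_of_w3⟩

/-- X → W₀ (landed `LiouvilleKillsProfile`). W₀ is NOT known to imply ¬(A) (no DSS ⇒ no truncation
bridge); it is the antecedent of the bridge split (D-C). -/
theorem w0_of_X : X → W0 := fun hX hL =>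
  Theorems.quantisedSymmetry_liouvilleKillsProfile_proof hL hX

/-- Perelman's backward RSS ansatz (Bradshaw–Tsai 2017 §5, Open Problem 5.2; rotation about the
`x₃`-axis with angular speed `α ≠ 0`), in the Type-I ancient mild class: its profile equation is a
STEADY elliptic system (Leray's equation `+ α·𝓛_ξ`, `ξ = e₃ × y`). -/
def BackwardRssProfileExists : Prop :=
  ∃ α : ℝ, α ≠ 0 ∧ ∃ u : ℝ → E3 → E3, IsAncientMildSolution 1 u ∧
    (∀ t < 0, AEStronglyMeasurable (u t) volume) ∧ IsRSS α u ∧ (∃ C₀ : ℝ, HasTypeIDecay C₀ u) ∧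
    ¬ (∀ t < 0, u t =ᵐ[volume] 0)

/-- An RSS profile is rotated-DSS for every factor, hence negates W₂'s rotated conjunct: the
elliptic sub-ansatz is a sufficient condition for the SYMMETRY-FREE intermediate W₂ … -/
theorem w2_of_rss (h : BackwardRssProfileExists) : W2 := by
  obtain ⟨α, -, u, hanc, hmeas, hrss, hdec, hnt⟩ := h
  dsimp only [W2, _root_.Summit.NavierStokesRegularity.NavierStokesRegularity.Theses.Blowup.BlowupTypeIDssProfile]
  intro hL
  have h2 : (1 : ℝ) < 2 := by norm_num
  exact hnt ((hL 2).2 (rotZLIE (2 * α * Real.log 2)) h2 u hanc hmeas (hrss 2 two_pos) hdec)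

/-- … but X's polyhedral clause EXCLUDES it (claimed support lemma, size M–L; proof: the slice
`u t` is equivariant under every conjugate `R(−θ) g R(θ)`, `g ∈ G`, `θ ∈ ℝ`; the closed subgroup of
`SO(3)` these generate contains the irreducible `G` and a continuum, so it is `SO(3)`; a continuous
`SO(3)`-equivariant weakly divergence-free field is `C·y/|y|³`, hence `0`). Inside X the problem is
irreducibly time-periodic: no relative-equilibrium (steady-in-a-rotating-frame) member. -/
def RssExcludedFromSector : Prop :=
  ∀ G : Subgroup (E3 ≃ₗᵢ[ℝ] E3), IsPolyhedral G → ∀ α : ℝ, α ≠ 0 →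
    ∀ u : ℝ → E3 → E3, IsRSS α u → IsEquivariant G u →
      (∀ t < 0, Continuous (u t)) → (∀ t < 0, IsWeaklyDivFree (u t)) → ∀ t < 0, ∀ x, u t x = 0

/-! ## Decomposition attempts -/

/-- Exact `G`-cell on the model period `[-1, -c⁻²]` (verbatim the hypothesis block of the landed
`polyhedralDssProfileExists_iff_cell`). -/
def IsCell (G : Subgroup (E3 ≃ₗᵢ[ℝ] E3)) (c : ℝ) (v : ℝ → E3 → E3) : Prop :=
  ContinuousOn (Function.uncurry v) (Set.Icc (-1 : ℝ) (-(c ^ 2)⁻¹) ×ˢ Set.univ) ∧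
  (∃ M : ℝ, ∀ t ∈ Set.Icc (-1 : ℝ) (-(c ^ 2)⁻¹), ∀ x, ‖v t x‖ ≤ M) ∧
  (∀ t ∈ Set.Icc (-1 : ℝ) (-(c ^ 2)⁻¹), IsWeaklyDivFree (v t)) ∧
  (∀ s t : ℝ, -1 ≤ s → s < t → t ≤ -(c ^ 2)⁻¹ → ∀ x,
    v t x = heatFlow (v s) (t - s) x - oseenDuhamel 1 s v v t x) ∧
  (∀ x, v (-(c ^ 2)⁻¹) x = c • v (-1) (c • x)) ∧
  (∀ g ∈ G, ∀ t ∈ Set.Icc (-1 : ℝ) (-(c ^ 2)⁻¹), ∀ x, v t (g x) = g (v t x))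

/-- One nontrivial polyhedral cell with `L⁴` datum. -/
def CellExists : Prop :=
  ∃ G, IsPolyhedral G ∧ ∃ c : ℝ, 1 < c ∧ ∃ v, IsCell G c v ∧ MemLp (v (-1)) 4 volume ∧
    ¬ (v (-1) =ᵐ[volume] 0)

/-- X ⟺ one cell (LANDED both ways: `polyhedralDssProfileExists_iff_cell`). -/
theorem X_iff_cellExists : X ↔ CellExists := by
  refine (Theorems.PolyhedralDssProfileExists.PolyhedralCell.polyhedralDssProfileExists_iff_cell).trans ?_
  constructor
  · rintro ⟨G, hfin, hdet, hirr, c, hc, v, hcell, hL4, hnt⟩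
    exact ⟨G, ⟨hfin, hdet, hirr⟩, c, hc, v, hcell, hL4, hnt⟩
  · rintro ⟨G, ⟨hfin, hdet, hirr⟩, c, hc, v, hcell, hL4, hnt⟩
    exact ⟨G, hfin, hdet, hirr, c, hc, v, hcell, hL4, hnt⟩

/-- (D-A) `ε`-approximate `G`-cell with scale-critical constant `C₀`: Oseen-mild and zoom-closing up
to `ε` in sup norm, Type-I bound `‖v(t,x)‖ ≤ C₀/(‖x‖ + √(−t))` — what a Galerkin / penalised /
regularised construction would output. -/
def IsApproxCell (G : Subgroup (E3 ≃ₗᵢ[ℝ] E3)) (c ε C₀ : ℝ) (v : ℝ → E3 → E3) : Prop :=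
  ContinuousOn (Function.uncurry v) (Set.Icc (-1 : ℝ) (-(c ^ 2)⁻¹) ×ˢ Set.univ) ∧
  (∀ t ∈ Set.Icc (-1 : ℝ) (-(c ^ 2)⁻¹), ∀ x, ‖v t x‖ ≤ C₀ / (‖x‖ + Real.sqrt (-t))) ∧
  (∀ t ∈ Set.Icc (-1 : ℝ) (-(c ^ 2)⁻¹), IsWeaklyDivFree (v t)) ∧
  (∀ s t : ℝ, -1 ≤ s → s < t → t ≤ -(c ^ 2)⁻¹ → ∀ x,
    ‖v t x - (heatFlow (v s) (t - s) x - oseenDuhamel 1 s v v t x)‖ ≤ ε) ∧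
  (∀ x, ‖v (-(c ^ 2)⁻¹) x - c • v (-1) (c • x)‖ ≤ ε) ∧
  (∀ g ∈ G, ∀ t ∈ Set.Icc (-1 : ℝ) (-(c ^ 2)⁻¹), ∀ x, v t (g x) = g (v t x))

/-- (D-A) piece 1 — approximate polyhedral cells at EVERY tolerance with ONE Type-I constant and ONE
non-degeneracy floor `δ` on some ball of radius `R` (the quantifier order `∃ C₀ δ R, ∀ ε` is what makes it
non-trivial — and what makes it X again, see the census; X ⇒ this is immediate: an exact cell is
ε-approximate for every ε). OPEN; no construction known. -/
def UniformApproxCells : Prop :=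
  ∃ G, IsPolyhedral G ∧ ∃ c : ℝ, 1 < c ∧ ∃ C₀ δ R : ℝ, 0 < δ ∧
    ∀ ε > 0, ∃ v, IsApproxCell G c ε C₀ v ∧ ∃ x : E3, ‖x‖ ≤ R ∧ δ ≤ ‖v (-1) x‖

/-- (D-A) piece 2 — compactness: PROVABLE (engine: tree `KNSS2009_lemma61_typeI_rate`, Arzelà–Ascoli
on the regularised end slice, the zoom relation transporting equicontinuity to the datum, dominated
convergence in the two identities; size L). -/
def ApproxCellCompactness : Prop :=
  ∀ G, IsPolyhedral G → ∀ c : ℝ, 1 < c → ∀ C₀ δ R : ℝ, 0 < δ →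
    (∀ ε > 0, ∃ v, IsApproxCell G c ε C₀ v ∧ ∃ x : E3, ‖x‖ ≤ R ∧ δ ≤ ‖v (-1) x‖) →
    ∃ v, IsCell G c v ∧ MemLp (v (-1)) 4 volume ∧ ¬ (v (-1) =ᵐ[volume] 0)

/-- (D-A) assembly, proved. -/
theorem X_of_DA (h₁ : UniformApproxCells) (h₂ : ApproxCellCompactness) : X := by
  obtain ⟨G, hG, c, hc, C₀, δ, R, hδ, h⟩ := h₁
  exact X_iff_cellExists.2 ⟨G, hG, c, hc, h₂ G hG c hc C₀ δ R hδ h⟩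

/-- (D-B) S3 — contraction on a closed ball of a Banach space has a fixed point (Banach; PROVABLE from
Mathlib, size S). The analytic heart of every radii-polynomial / Newton–Kantorovich CAP. -/
def ClosedBallContraction : Prop :=
  ∀ (V : Type) [NormedAddCommGroup V] [NormedSpace ℝ V] [CompleteSpace V]
    (T : V → V) (x₀ : V) (r q : ℝ), 0 ≤ r → 0 ≤ q → q < 1 →
    Set.MapsTo T (Metric.closedBall x₀ r) (Metric.closedBall x₀ r) →
    (∀ x ∈ Metric.closedBall x₀ r, ∀ y ∈ Metric.closedBall x₀ r, ‖T x - T y‖ ≤ q * ‖x - y‖) →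
    ∃ x ∈ Metric.closedBall x₀ r, T x = x

/-- (D-B) S1 — an UNPINNED certificate: some Banach space, some contraction set-up on a closed ball,
whose fixed points decode to nontrivial polyhedral cells. (A real CAP pins `V` = weighted continuous
`G`-symmetric solenoidal fields and `T = x − A·(id − 𝓡_G)(x)` with `𝓡_G` the NS period map — a
DEFINITION item first; unpinned, S1 is X in costume: `unpinnedCertificate_of_cellExists`.) -/
def UnpinnedCertificate : Prop :=
  ∃ G, IsPolyhedral G ∧ ∃ c : ℝ, 1 < c ∧
    ∃ (V : Type) (_ : NormedAddCommGroup V) (_ : NormedSpace ℝ V) (_ : CompleteSpace V)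
      (T : V → V) (dec : V → ℝ → E3 → E3) (x₀ : V) (r q : ℝ),
      0 ≤ r ∧ 0 ≤ q ∧ q < 1 ∧
      Set.MapsTo T (Metric.closedBall x₀ r) (Metric.closedBall x₀ r) ∧
      (∀ x ∈ Metric.closedBall x₀ r, ∀ y ∈ Metric.closedBall x₀ r, ‖T x - T y‖ ≤ q * ‖x - y‖) ∧
      (∀ x ∈ Metric.closedBall x₀ r, T x = x →
        IsCell G c (dec x) ∧ MemLp (dec x (-1)) 4 volume ∧ ¬ (dec x (-1) =ᵐ[volume] 0))

/-- (D-B) assembly, proved. -/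
theorem X_of_DB (h₃ : ClosedBallContraction) (h₁ : UnpinnedCertificate) : X := by
  obtain ⟨G, hG, c, hc, V, i₁, i₂, i₃, T, dec, x₀, r, q, hr, hq, hq1, hmaps, hlip, hdec⟩ := h₁
  obtain ⟨x, hx, hTx⟩ := h₃ V T x₀ r q hr hq hq1 hmaps hlip
  exact X_iff_cellExists.2 ⟨G, hG, c, hc, dec x, hdec x hx hTx⟩

/-- (D-B) the degenerate witness: one exact cell gives an unpinned certificate (`V = ℝ`, `T ≡ 0`,
`r = q = 0`, constant decoder). So the certificate piece, unless PINNED to the NS period map by a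
definition item, carries exactly the content of X. -/
theorem unpinnedCertificate_of_cellExists (h : CellExists) : UnpinnedCertificate := by
  obtain ⟨G, hG, c, hc, v, hv⟩ := h
  refine ⟨G, hG, c, hc, ℝ, inferInstance, inferInstance, inferInstance,
    fun _ => 0, fun _ => v, 0, 0, 0, le_rfl, le_rfl, zero_lt_one, ?_, ?_, ?_⟩
  · intro x hx
    simp
  · intro x hx y hy
    simp
  · intro x hx hTx
    exact hv

/-- (D-C) the bridge split's hard half: "DSS-isation" — a Type-I polyhedral ancient solution can be
upgraded to a DISCRETELY SELF-SIMILAR one (a closing lemma for Leray's similarity semiflow on the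
Type-I eternal set). No mechanism known (no hyperbolicity for Anosov closing, Birkhoff recurrence gives
minimal sets, not periodic orbits). -/
def DssIsation : Prop := W0 → X

/-- (D-C) assembly (modus ponens; `trivial_seam`). -/
theorem X_of_DC (h₀ : W0) (h : DssIsation) : X := h h₀

/-! ## Strengthen -/

/-- S⁺: a HYPERBOLIC polyhedral Type-I DSS orbit (tree notion `IsHyperbolicTypeIDSSOrbit`, trivial
rotation) — what a CAP would certify and what continuation arguments need. -/
def HyperbolicPolyhedralProfile : Prop :=
  ∃ G, IsPolyhedral G ∧ ∃ (c : ℝ) (u : ℝ → E3 → E3),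
    IsHyperbolicTypeIDSSOrbit c (LinearIsometryEquiv.refl ℝ E3) u ∧ IsEquivariant G u

/-- S⁺ → X (projection of clause (a)). -/
theorem X_of_hyperbolic (h : HyperbolicPolyhedralProfile) : X := by
  obtain ⟨G, hG, c, u, hh, heqv⟩ := h
  have hh' : IsHyperbolicTypeIDSSOrbitW gaussianWeight c (LinearIsometryEquiv.refl ℝ E3) u := hh
  have hp := hh'.toIsTypeIDSSProfile
  exact X_iff.2 ⟨G, hG, c, hp.one_lt, u,
    ⟨hp.isAncientMildSolution, hp.aestronglyMeasurable, isRotatedDSS_refl_iff.1 hp.isRotatedDSS,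
      hp.hasTypeIDecay, hp.nontrivial⟩, heqv⟩

end Summit.NavierStokesRegularity.NavierStokesRegularity.Cruxes.PolyhedralDssProfileExists.S19g17

end
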